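import Literature.MathematicalPhysics.KineticTheory.FouriersLaw
import Mathlib.Analysis.Calculus.Deriv.Shift
import Mathlib.Analysis.Calculus.ContDiff.Basic
import Mathlib.Analysis.Calculus.ContDiff.Comp
import Mathlib.MeasureTheory.Integral.Bochner.Basic
import HarnessLib

/-!
# The left–right reflection of an oscillator chain between two heat baths

Topic `Literature/MathematicalPhysics/KineticTheory` (API of the model of `FouriersLaw.lean`,
serving the finite-`N` items of `AtomisticToContinuum/FouriersLaw`, e.g.
stmt-AtomisticToContinuum-0717 `FiniteResponseOfUnique`: the steady current is odd under the
exchange of the bath temperatures).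

The site reflection `i ↦ N-1-i` (`Fin.rev`) acts on phase space by
`(q, p) ↦ (q ∘ rev, p ∘ rev)`. For a chain `P : OscillatorChain` with EVEN interaction potential
`V` (the pinning `U` is the same at every site by construction) it leaves the Hamiltonian
invariant, conjugates the generator with bath temperatures `(T_L, T_R)` to the generator with the
baths EXCHANGED, `L_{T_L,T_R}(f ∘ R)(x) = (L_{T_R,T_L} f)(R x)`, and reverses the bond currents,
`j_i(Rx) = -j_{rev(i+1)}(x)`. Consequently the push-forward of a weak steady state at `(T_L, T_R)`
is a weak steady state at `(T_R, T_L)` with the opposite total current, and — whenever weak steady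
states are unique — `J_N(T_R, T_L) = -J_N(T_L, T_R)`: the response function
`δ ↦ J_N(T+δ/2, T-δ/2)` of Bonetto–Lebowitz–Rey-Bellet's conductivity is odd.

* `siteReflection N`, `siteReflectionEquiv N` (a measurable involution), smoothness;
* `partialQ_comp_siteReflection`, `partialP_comp_siteReflection`;
* `OscillatorChain.hamiltonian_siteReflection`, `OscillatorChain.generator_comp_siteReflection`;
* `OscillatorChain.bondCurrent_siteReflection`, `OscillatorChain.bondCurrent_eq_zero_of_last`,
  `OscillatorChain.sum_bondCurrent_siteReflection`, `OscillatorChain.totalCurrent_map_siteReflection`;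
* `OscillatorChain.IsSteadyState.map_siteReflection`;
* `OscillatorChain.totalCurrent_eq_neg_of_unique` (uniqueness at `(T_R,T_L)` ⇒ `J(T_R,T_L) = -J(T_L,T_R)`),
  and the `pinnedChain` instances (`V(r) = r²/2 + βr⁴/4` is even).

## References

* F. Bonetto, J. L. Lebowitz, L. Rey-Bellet, *Fourier's law: a challenge to theorists* (2000),
  §5 (the symmetric two-bath set-up). The reflection covariance itself is folklore.
-/

noncomputable section

open MeasureTheory Filter
open scoped ContDiff

namespace Literature.MathematicalPhysics.KineticTheory.HeatConduction

variable {N : ℕ}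

/-! ### The site reflection on phase space -/

/-- The left–right (site) reflection of phase space: `(q, p) ↦ (q ∘ rev, p ∘ rev)` with
`rev i = N - 1 - i`. [folklore] -/
def siteReflection (N : ℕ) (x : PhaseSpace N) : PhaseSpace N := (x.1 ∘ Fin.rev, x.2 ∘ Fin.rev)

/-- Positions of the reflected configuration. [folklore] -/
@[simp] theorem siteReflection_fst (x : PhaseSpace N) (i : Fin N) :
    (siteReflection N x).1 i = x.1 (Fin.rev i) := rfl

/-- Momenta of the reflected configuration. [folklore] -/
@[simp] theorem siteReflection_snd (x : PhaseSpace N) (i : Fin N) :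
    (siteReflection N x).2 i = x.2 (Fin.rev i) := rfl

/-- The site reflection is an involution. [folklore] -/
@[simp] theorem siteReflection_siteReflection (x : PhaseSpace N) :
    siteReflection N (siteReflection N x) = x := by
  ext i <;> simp [siteReflection]

/-- The site reflection is a continuous linear map (a coordinate permutation). [folklore] -/
theorem siteReflection_eq_continuousLinearMap :
    ∃ A : PhaseSpace N →L[ℝ] PhaseSpace N, ∀ x, siteReflection N x = A x := by
  refine ⟨(ContinuousLinearMap.pi fun i => (ContinuousLinearMap.proj (Fin.rev i)).comp
      (ContinuousLinearMap.fst ℝ (Fin N → ℝ) (Fin N → ℝ))).prod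
    (ContinuousLinearMap.pi fun i => (ContinuousLinearMap.proj (Fin.rev i)).comp
      (ContinuousLinearMap.snd ℝ (Fin N → ℝ) (Fin N → ℝ))), fun x => ?_⟩
  ext i <;> rfl

/-- The site reflection is smooth. [folklore] -/
theorem contDiff_siteReflection {n : WithTop ℕ∞} : ContDiff ℝ n (siteReflection N) := by
  obtain ⟨A, hA⟩ := siteReflection_eq_continuousLinearMap (N := N)
  have : siteReflection N = A := funext hA
  rw [this]
  exact A.contDiff

/-- The site reflection is continuous. [folklore] -/
theorem continuous_siteReflection : Continuous (siteReflection N) :=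
  contDiff_siteReflection (n := 0) |>.continuous

/-- The site reflection is measurable. [folklore] -/
theorem measurable_siteReflection : Measurable (siteReflection N) :=
  continuous_siteReflection.measurable

/-- The site reflection as a measurable involution of phase space. [folklore] -/
def siteReflectionEquiv (N : ℕ) : PhaseSpace N ≃ᵐ PhaseSpace N where
  toFun := siteReflection N
  invFun := siteReflection N
  left_inv := siteReflection_siteReflection
  right_inv := siteReflection_siteReflection
  measurable_toFun := measurable_siteReflection
  measurable_invFun := measurable_siteReflection

/-- The measurable equivalence acts as `siteReflection`. [folklore] -/
@[simp] theorem siteReflectionEquiv_apply (x : PhaseSpace N) :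
    siteReflectionEquiv N x = siteReflection N x := rfl

/-- Smooth compactly supported observables stay so under the reflection. [folklore] -/
theorem hasCompactSupport_comp_siteReflection {f : PhaseSpace N → ℝ} (hf : HasCompactSupport f) :
    HasCompactSupport (f ∘ siteReflection N) := by
  refine hf.comp_isClosedEmbedding ?_
  exact (Homeomorph.mk ⟨siteReflection N, siteReflection N, siteReflection_siteReflection,
    siteReflection_siteReflection⟩ continuous_siteReflection continuous_siteReflection).isClosedEmbedding

/-! ### Coordinate derivatives under the reflection -/

/-- Updating a coordinate and then reflecting = reflecting and then updating the reflected
coordinate. [folklore] -/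
theorem update_comp_rev (g : Fin N → ℝ) (i : Fin N) (t : ℝ) :
    Function.update g i t ∘ Fin.rev = Function.update (g ∘ Fin.rev) (Fin.rev i) t := by
  have h := Function.update_comp_equiv g Fin.revPerm i t
  have hc : (⇑(Fin.revPerm : Equiv.Perm (Fin N)) : Fin N → Fin N) = Fin.rev := by
    funext k; simp
  simpa [hc] using h

/-- `∂_{q_i}(f ∘ R) = (∂_{q_{rev i}} f) ∘ R`. [folklore] -/
theorem partialQ_comp_siteReflection (i : Fin N) (f : PhaseSpace N → ℝ) (x : PhaseSpace N) :
    partialQ i (f ∘ siteReflection N) x = partialQ (Fin.rev i) f (siteReflection N x) := by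
  unfold partialQ
  have h : (fun t => (f ∘ siteReflection N) (Function.update x.1 i t, x.2)) =
      fun t => f (Function.update (x.1 ∘ Fin.rev) (Fin.rev i) t, x.2 ∘ Fin.rev) := by
    funext t
    simp only [Function.comp_apply, siteReflection, update_comp_rev]
  rw [h]
  simp [siteReflection]

/-- `∂_{p_i}(f ∘ R) = (∂_{p_{rev i}} f) ∘ R`. [folklore] -/
theorem partialP_comp_siteReflection (i : Fin N) (f : PhaseSpace N → ℝ) (x : PhaseSpace N) :
    partialP i (f ∘ siteReflection N) x = partialP (Fin.rev i) f (siteReflection N x) := by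
  unfold partialP
  have h : (fun t => (f ∘ siteReflection N) (x.1, Function.update x.2 i t)) =
      fun t => f (x.1 ∘ Fin.rev, Function.update (x.2 ∘ Fin.rev) (Fin.rev i) t) := by
    funext t
    simp only [Function.comp_apply, siteReflection, update_comp_rev]
  rw [h]
  simp [siteReflection]

/-- `∂²_{p_i}(f ∘ R) = (∂²_{p_{rev i}} f) ∘ R`. [folklore] -/
theorem partialP_partialP_comp_siteReflection (i : Fin N) (f : PhaseSpace N → ℝ) (x : PhaseSpace N) :
    partialP i (partialP i (f ∘ siteReflection N)) x =
      partialP (Fin.rev i) (partialP (Fin.rev i) f) (siteReflection N x) := by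
  have h : partialP i (f ∘ siteReflection N) = partialP (Fin.rev i) f ∘ siteReflection N :=
    funext fun y => partialP_comp_siteReflection i f y
  rw [h, partialP_comp_siteReflection]

namespace OscillatorChain

variable (P : OscillatorChain)

/-! ### The Hamiltonian and the generator -/

/-- For an even interaction `V`, the Hamiltonian is reflection invariant. [folklore] -/
theorem hamiltonian_siteReflection (hV : ∀ r, P.V (-r) = P.V r) (N : ℕ) (x : PhaseSpace N) :
    P.hamiltonian N (siteReflection N x) = P.hamiltonian N x := by
  unfold hamiltonian
  congr 1
  · simp only [siteReflection_fst, siteReflection_snd]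
    exact Equiv.sum_comp Fin.revPerm (fun i => x.2 i ^ 2 / 2 + P.U (x.1 i))
  · simp only [siteReflection_fst]
    -- reindex both sums by `rev` and swap them
    have h1 : ∑ i : Fin N, ∑ j : Fin N, (if j.val = i.val + 1 then P.V (x.1 (Fin.rev j) - x.1 (Fin.rev i)) else 0)
        = ∑ i : Fin N, ∑ j : Fin N,
            (if (Fin.rev j).val = (Fin.rev i).val + 1 then P.V (x.1 j - x.1 i) else 0) := by
      rw [← Equiv.sum_comp Fin.revPerm]
      refine Finset.sum_congr rfl fun i _ => ?_
      rw [← Equiv.sum_comp Fin.revPerm]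
      refine Finset.sum_congr rfl fun j _ => ?_
      simp
    rw [h1, Finset.sum_comm]
    refine Finset.sum_congr rfl fun i _ => Finset.sum_congr rfl fun j _ => ?_
    have hi := i.isLt
    have hj := j.isLt
    by_cases h : j.val = i.val + 1
    · have h' : (Fin.rev i).val = (Fin.rev j).val + 1 := by simp [Fin.val_rev]; omega
      rw [if_pos h', if_pos h, ← hV, neg_sub]
    · have h' : ¬ (Fin.rev i).val = (Fin.rev j).val + 1 := by simp [Fin.val_rev]; omega
      rw [if_neg h', if_neg h]

/-- **Reflection covariance of the generator**: `L_{T_L,T_R}(f ∘ R)(x) = (L_{T_R,T_L} f)(R x)` —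
the Hamiltonian vector field is reflection equivariant and the two bath operators are exchanged.
[folklore] -/
theorem generator_comp_siteReflection (hV : ∀ r, P.V (-r) = P.V r) (N : ℕ) (T_L T_R : ℝ)
    (f : PhaseSpace N → ℝ) (x : PhaseSpace N) :
    P.generator N T_L T_R (f ∘ siteReflection N) x = P.generator N T_R T_L f (siteReflection N x) := by
  have hH : P.hamiltonian N = P.hamiltonian N ∘ siteReflection N :=
    funext fun y => (P.hamiltonian_siteReflection hV N y).symm
  have hQH : ∀ i : Fin N, partialQ i (P.hamiltonian N) x =
      partialQ (Fin.rev i) (P.hamiltonian N) (siteReflection N x) := by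
    intro i
    conv_lhs => rw [hH]
    exact partialQ_comp_siteReflection i _ x
  unfold generator
  simp only [partialQ_comp_siteReflection, partialP_comp_siteReflection,
    partialP_partialP_comp_siteReflection, hQH]
  congr 1
  · -- Hamiltonian part: reindex by `rev`
    rw [← Equiv.sum_comp Fin.revPerm]
    refine Finset.sum_congr rfl fun i _ => ?_
    simp [siteReflection]
  · congr 1
    rw [← Equiv.sum_comp Fin.revPerm]
    refine Finset.sum_congr rfl fun i _ => ?_
    have hi := i.isLt
    have h0 : ((Fin.rev i).val = 0) = (i.val = N - 1) := by
      simp only [Fin.val_rev]; exact propext ⟨fun h => by omega, fun h => by omega⟩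
    have h1 : ((Fin.rev i).val = N - 1) = (i.val = 0) := by
      simp only [Fin.val_rev]; exact propext ⟨fun h => by omega, fun h => by omega⟩
    simp only [Fin.revPerm_apply, Fin.rev_rev, siteReflection_snd, h0, h1]
    rw [add_comm]

/-! ### The bond currents -/

/-- The last site carries no outgoing bond: `j_i ≡ 0` if `i = N - 1`. [folklore] -/
theorem bondCurrent_eq_zero_of_last (N : ℕ) (i : Fin N) (hi : i.val + 1 = N) (x : PhaseSpace N) :
    P.bondCurrent N i x = 0 := by
  unfold bondCurrent
  refine Finset.sum_eq_zero fun j _ => ?_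
  have hj := j.isLt
  rw [if_neg (by omega)]

/-- The derivative of an even potential is odd (no differentiability needed). [folklore] -/
theorem deriv_V_neg (hV : ∀ r, P.V (-r) = P.V r) (r : ℝ) : deriv P.V (-r) = -deriv P.V r := by
  have h : (fun s => P.V (-s)) = P.V := funext hV
  have h2 := deriv_comp_neg (f := P.V) r
  rw [h] at h2
  -- `h2 : deriv V r = -deriv V (-r)`
  linarith

/-- **The bond currents are reflection-odd**: for the bond `(i, i+1)`,
`j_i(R x) = -j_{rev(i+1)}(x)` (the reflected bond is `(rev(i+1), rev i)`). [folklore] -/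
theorem bondCurrent_siteReflection (hV : ∀ r, P.V (-r) = P.V r) (N : ℕ) (i j : Fin N)
    (hij : j.val = i.val + 1) (x : PhaseSpace N) :
    P.bondCurrent N i (siteReflection N x) = -P.bondCurrent N (Fin.rev j) x := by
  unfold bondCurrent
  have hi := i.isLt
  have hj := j.isLt
  rw [Finset.sum_eq_single j, Finset.sum_eq_single (Fin.rev i)]
  · have h1 : (Fin.rev i).val = (Fin.rev j).val + 1 := by simp [Fin.val_rev]; omega
    rw [if_pos hij, if_pos h1]
    simp only [siteReflection_fst, siteReflection_snd]
    rw [show x.1 (Fin.rev j) - x.1 (Fin.rev i) = -(x.1 (Fin.rev i) - x.1 (Fin.rev j)) by ring,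
      P.deriv_V_neg hV]
    ring
  · intro k _ hk
    have : ¬ (k.val = (Fin.rev j).val + 1) := by
      intro h
      apply hk
      ext
      simp [Fin.val_rev] at h ⊢
      omega
    rw [if_neg this]
  · intro h; exact absurd (Finset.mem_univ _) h
  · intro k _ hk
    have : ¬ (k.val = i.val + 1) := fun h => hk (Fin.ext (by omega))
    rw [if_neg this]
  · intro h; exact absurd (Finset.mem_univ _) h

/-- **The total current observable is reflection-odd**: `Σ_i j_i(R x) = -Σ_i j_i(x)`.
[folklore] -/
theorem sum_bondCurrent_siteReflection (hV : ∀ r, P.V (-r) = P.V r) (N : ℕ) (x : PhaseSpace N) :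
    ∑ i : Fin N, P.bondCurrent N i (siteReflection N x) = -∑ i : Fin N, P.bondCurrent N i x := by
  cases N with
  | zero => simp
  | succ n =>
    rw [Fin.sum_univ_castSucc, Fin.sum_univ_castSucc]
    have hlast : P.bondCurrent (n + 1) (Fin.last n) x = 0 :=
      P.bondCurrent_eq_zero_of_last (n + 1) (Fin.last n) (by simp) x
    have hlast' : P.bondCurrent (n + 1) (Fin.last n) (siteReflection (n + 1) x) = 0 :=
      P.bondCurrent_eq_zero_of_last (n + 1) (Fin.last n) (by simp) _
    rw [hlast, hlast', add_zero, add_zero]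
    have h : ∀ i : Fin n, P.bondCurrent (n + 1) (Fin.castSucc i) (siteReflection (n + 1) x) =
        -P.bondCurrent (n + 1) (Fin.castSucc (Fin.rev i)) x := by
      intro i
      rw [P.bondCurrent_siteReflection hV (n + 1) (Fin.castSucc i) i.succ (by simp) x, Fin.rev_succ]
    simp only [h, Finset.sum_neg_distrib]
    have hre := Equiv.sum_comp Fin.revPerm (fun i => P.bondCurrent (n + 1) (Fin.castSucc i) x)
    simp only [Fin.revPerm_apply] at hre
    rw [hre]

/-- **The total current reverses under the reflection of the state**:
`totalCurrent (R_* μ) = -totalCurrent μ`, for every measure under which the bond currents are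
integrable. [folklore] -/
theorem totalCurrent_map_siteReflection (hV : ∀ r, P.V (-r) = P.V r) (N : ℕ)
    (μ : Measure (PhaseSpace N)) (hint : ∀ i : Fin N, Integrable (P.bondCurrent N i) μ) :
    P.totalCurrent (μ.map (siteReflection N)) = -P.totalCurrent μ := by
  unfold totalCurrent
  have hmap : ∀ i : Fin N, ∫ x, P.bondCurrent N i x ∂(μ.map (siteReflection N)) =
      ∫ x, P.bondCurrent N i (siteReflection N x) ∂μ := fun i =>
    integral_map_equiv (siteReflectionEquiv N) (P.bondCurrent N i)
  simp only [hmap]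
  -- integrability of the reflected currents (each is `0` or minus another current)
  have hint' : ∀ i : Fin N, Integrable (fun x => P.bondCurrent N i (siteReflection N x)) μ := by
    intro i
    by_cases h : i.val + 1 < N
    · have heq : (fun x => P.bondCurrent N i (siteReflection N x)) =
          fun x => -P.bondCurrent N (Fin.rev ⟨i.val + 1, h⟩) x :=
        funext fun x => P.bondCurrent_siteReflection hV N i ⟨i.val + 1, h⟩ rfl x
      rw [heq]
      exact (hint _).neg
    · have heq : (fun x => P.bondCurrent N i (siteReflection N x)) = fun _ => 0 :=
        funext fun x => P.bondCurrent_eq_zero_of_last N i (by have := i.isLt; omega) _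
      rw [heq]
      exact integrable_zero _ _ _
  rw [← integral_finsetSum _ fun i _ => hint' i, ← integral_finsetSum _ fun i _ => hint i,
    ← integral_neg]
  exact integral_congr_ae (Eventually.of_forall fun x => P.sum_bondCurrent_siteReflection hV N x)

/-! ### Steady states -/

/-- **The reflection of a weak steady state is a weak steady state with the baths exchanged.**
[folklore] -/
theorem IsSteadyState.map_siteReflection {P : OscillatorChain} (hV : ∀ r, P.V (-r) = P.V r)
    {N : ℕ} {T_L T_R : ℝ} {μ : Measure (PhaseSpace N)} (h : P.IsSteadyState N T_L T_R μ) :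
    P.IsSteadyState N T_R T_L (μ.map (siteReflection N)) := by
  obtain ⟨hprob, hgen, hint⟩ := h
  haveI := hprob
  refine ⟨Measure.isProbabilityMeasure_map measurable_siteReflection.aemeasurable, fun f hf hfc => ?_,
    fun i => ?_⟩
  · rw [show (∫ x, P.generator N T_R T_L f x ∂(μ.map (siteReflection N))) =
        ∫ x, P.generator N T_R T_L f (siteReflection N x) ∂μ from
      integral_map_equiv (siteReflectionEquiv N) _]
    simp only [← P.generator_comp_siteReflection hV N T_L T_R f]
    exact hgen (f ∘ siteReflection N) (ContDiff.comp hf contDiff_siteReflection)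
      (hasCompactSupport_comp_siteReflection hfc)
  · refine (integrable_map_equiv (siteReflectionEquiv N) (P.bondCurrent N i)).2 ?_
    by_cases hi : i.val + 1 < N
    · have heq : (P.bondCurrent N i ∘ siteReflectionEquiv N) =
          fun x => -P.bondCurrent N (Fin.rev ⟨i.val + 1, hi⟩) x :=
        funext fun x => P.bondCurrent_siteReflection hV N i ⟨i.val + 1, hi⟩ rfl x
      rw [heq]
      exact (hint _).neg
    · have heq : (P.bondCurrent N i ∘ siteReflectionEquiv N) = fun _ => 0 :=
        funext fun x => P.bondCurrent_eq_zero_of_last N i (by have := i.isLt; omega) _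
      rw [heq]
      exact integrable_zero _ _ _

/-- **Under uniqueness the steady current is odd under the exchange of the baths**: if weak
steady states at `(T_R, T_L)` are unique, `μ` is a steady state at `(T_L, T_R)` and `ν` one at
`(T_R, T_L)`, then `totalCurrent ν = -totalCurrent μ`. [folklore] -/
theorem totalCurrent_eq_neg_of_unique {P : OscillatorChain} (hV : ∀ r, P.V (-r) = P.V r)
    {N : ℕ} {T_L T_R : ℝ}
    (huniq : ∀ ν ν' : Measure (PhaseSpace N),
      P.IsSteadyState N T_R T_L ν → P.IsSteadyState N T_R T_L ν' → ν = ν')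
    {μ ν : Measure (PhaseSpace N)} (hμ : P.IsSteadyState N T_L T_R μ)
    (hν : P.IsSteadyState N T_R T_L ν) :
    P.totalCurrent ν = -P.totalCurrent μ := by
  rw [huniq ν _ hν (hμ.map_siteReflection hV), P.totalCurrent_map_siteReflection hV N μ hμ.2.2]

end OscillatorChain

/-! ### The pinned anharmonic chain -/

/-- The FPU-`β` interaction `r²/2 + βr⁴/4` is even. [folklore] -/
theorem pinnedChain_V_neg (ω₂ lam β γ r : ℝ) :
    (pinnedChain ω₂ lam β γ).V (-r) = (pinnedChain ω₂ lam β γ).V r := by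
  show (-r) ^ 2 / 2 + β * (-r) ^ 4 / 4 = r ^ 2 / 2 + β * r ^ 4 / 4
  ring

/-- The reflection of a weak steady state of the pinned chain at `(T_L, T_R)` is a weak steady
state at `(T_R, T_L)`. [folklore] -/
theorem pinnedChain_isSteadyState_map_siteReflection {ω₂ lam β γ : ℝ} {N : ℕ} {T_L T_R : ℝ}
    {μ : Measure (PhaseSpace N)} (h : (pinnedChain ω₂ lam β γ).IsSteadyState N T_L T_R μ) :
    (pinnedChain ω₂ lam β γ).IsSteadyState N T_R T_L (μ.map (siteReflection N)) :=
  h.map_siteReflection (pinnedChain_V_neg ω₂ lam β γ)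

/-- **Oddness of the steady current of the pinned chain under uniqueness**: with weak steady
states unique at `(T_R, T_L)`, `J_N(T_R, T_L) = -J_N(T_L, T_R)`; in particular the response
function `δ ↦ J_N(T + δ/2, T - δ/2)` is odd and `J_N(T, T) = 0`. [folklore] -/
theorem pinnedChain_totalCurrent_eq_neg_of_unique {ω₂ lam β γ : ℝ} {N : ℕ} {T_L T_R : ℝ}
    (huniq : ∀ ν ν' : Measure (PhaseSpace N),
      (pinnedChain ω₂ lam β γ).IsSteadyState N T_R T_L ν →
        (pinnedChain ω₂ lam β γ).IsSteadyState N T_R T_L ν' → ν = ν')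
    {μ ν : Measure (PhaseSpace N)} (hμ : (pinnedChain ω₂ lam β γ).IsSteadyState N T_L T_R μ)
    (hν : (pinnedChain ω₂ lam β γ).IsSteadyState N T_R T_L ν) :
    (pinnedChain ω₂ lam β γ).totalCurrent ν = -(pinnedChain ω₂ lam β γ).totalCurrent μ :=
  OscillatorChain.totalCurrent_eq_neg_of_unique (pinnedChain_V_neg ω₂ lam β γ) huniq hμ hν

end Literature.MathematicalPhysics.KineticTheory.HeatConduction

end
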